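import Summits.BirchSwinnertonDyer.Rank1Residual.Additive.KatoDescentRankOneCountContraOfFacts
import HarnessLib

set_option autoImplicit false

/-!
# Stub 3 `stub_rankOneCountReadingKato` of the Kato–Perrin-Riou skeletons v4 REDUCED — GENERAL FORM over a DISPLAYED
# finiteness of `(D.H2)_Γ` (conjunct (i)) in place of the named fact `Kato2004.finite_descentCokernel_of_rankOne`
# (seat `bsd-cm-prr-ty1` g9, cell `bsd-cm`; theorems only: no definition, no named fact, no instance, no `sorry`)

Companion of g7's `KatoDescentRankOneCountContraOfFacts.lean` (part 2 of the seat's kernel cut of stub 3 of both registered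
skeletons — cruxes stmt-BirchSwinnertonDyer-19945 `…/Lines/kato_perrin_riou_zp.lean`, stmt-BirchSwinnertonDyer-19223
`…/Lines/kato_perrin_riou_istar.lean`; cell bsd-potss's held input 27322). That file's reduction
`ContraCount.rankOneCountReading_contra_of_facts h₁ … h₇` uses cn100's named fact `Kato2004.finite_descentCokernel_of_rankOne`
(`hfd`) at exactly ONE point: to obtain conjunct (i) `Finite (coinvariants p D.H2)` through part 1's
`rankOneCountReading_finite_of_gzk_of_finite_descentCokernel hGZK hfd`. THIS FILE states the same reduction with that
conjunct DISPLAYED as the hypothesis `hfin : r_an(W) = 1 → Ш(W) finite → IsKatoZetaDescentDatumOfContra W p D →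
Finite (coinvariants p D.H2)` — so that g9's kernel theorem `LocPKummer.rankOneCountReading_finite_of_gzk`
(`KatoDescentIntegralH1RankOne.lean`: conjunct (i) from Gross–Zagier–Kolyvagin ALONE, through the base-level rank bound
`rank_{ℤ_p} H¹(ℤ[1/p], T_pW) ≤ 1`) can be fed in, removing `Kato2004.finite_descentCokernel_of_rankOne` from the stub's
residual. The proof is g7's, verbatim but for the line producing conjunct (i); it is repeated here (not patched into
the 398-line original) only because of the 400-line bound on proof files. The two `p`-adic valuation helpers of g7's §1
are private there and are re-proved.

HONEST LABEL: conditional reduction on displayed hypotheses; no stub or item is closed; nothing is registered; nothing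
is asserted on 19945 / 19223; Kato's Main Conjecture and Perrin-Riou's conjecture are not touched; BSD is not proved
for any curve.

References: [Kato2004Asterisque] §13.9–13.12 (pp. 229–231), (14.9.3) (p. 240), §14.14 (p. 243), Prop. 14.16 (p. 244);
[BurnsKuriharaSano2019] Thm. 7.3 / 7.8 (d); [BlochKato1990] 3.10–3.11; [Darmon2004] Thm. 3.22; [SilvermanAEC2009] IV.6.4.
-/

noncomputable section

open scoped Classical NumberField BigOperators

open WeierstrassCurve Field IsDedekindDomain Rat.HeightOneSpectrum Literature.NumberTheory.EllipticCurves
  Literature.NumberTheory.EllipticCurves.ModularForms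
  Literature.NumberTheory.EllipticCurves.Rank1Residual Literature.NumberTheory.EllipticCurves.Rank1Residual.Typed
  Literature.NumberTheory.EllipticCurves.Kato2004 Literature.NumberTheory.EllipticCurves.IwasawaAlgebra
  Literature.NumberTheory.EllipticCurves.Kato2004.EulerSystemValues
  Literature.NumberTheory.GaloisRepresentations
open Summit.BirchSwinnertonDyer.BirchSwinnertonDyer.Theorems.CongruentShaFreeCutKatoDescentDatumOfH2
  Summit.BirchSwinnertonDyer.BirchSwinnertonDyer.Theorems.CongruentShaFreeCutKatoKummerLogTorsion

namespace Summit.BirchSwinnertonDyer.Rank1Residual.Additive.ContraCount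

/-! ## §1 `p`-adic valuation helpers (g7's, private there) -/

section Valuation

variable {p : ℕ} [Fact p.Prime]

/-- A `p`-adic number of norm `1` has valuation `0`. [folklore] -/
private theorem valuation_eq_zero_of_norm_eq_one_aux {w : ℚ_[p]} (hw : ‖w‖ = 1) : w.valuation = 0 := by
  have hw0 : w ≠ 0 := fun h => by rw [h, norm_zero] at hw; exact zero_ne_one hw
  rw [Padic.norm_eq_zpow_neg_valuation hw0] at hw
  have hp : (1 : ℝ) < p := by exact_mod_cast (Fact.out : p.Prime).one_lt
  have := (zpow_right_injective₀ (zero_lt_one.trans hp) hp.ne') (hw.trans (zpow_zero _).symm)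
  simpa using this

/-- `v(a·b/c/d²) = v a + v b − v c − 2·v d` for non-zero `p`-adic numbers. [folklore] -/
private theorem valuation_mul_div_div_sq_aux {a b c d : ℚ_[p]} (ha : a ≠ 0) (hb : b ≠ 0) (hc : c ≠ 0) (hd : d ≠ 0) :
    (a * b / c / d ^ 2).valuation = a.valuation + b.valuation - c.valuation - 2 * d.valuation := by
  rw [div_eq_mul_inv, div_eq_mul_inv, Padic.valuation_mul (mul_ne_zero (mul_ne_zero ha hb) (inv_ne_zero hc))
      (inv_ne_zero (pow_ne_zero 2 hd)), Padic.valuation_mul (mul_ne_zero ha hb) (inv_ne_zero hc),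
    Padic.valuation_mul ha hb, Padic.valuation_inv, Padic.valuation_inv, Padic.valuation_pow]
  ring

end Valuation

/-! ## §2 The reduction over a displayed conjunct (i) -/

section Reduction

/-- **STUB 3 REDUCED — GENERAL FORM over a displayed finiteness of `(D.H2)_Γ`** (seat bsd-cm-prr-ty1 g9): the same
reduction as g7's `rankOneCountReading_contra_of_facts` (`KatoDescentRankOneCountContraOfFacts.lean`), with cn100's
named fact `Kato2004.finite_descentCokernel_of_rankOne` replaced by the hypothesis it was used for — conjunct (i) itself,
`hfin : r_an(W) = 1 → Ш(W) finite → IsKatoZetaDescentDatumOfContra W p D → Finite (coinvariants p D.H2)` (the shape of part 1's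
`rankOneCountReading_finite_of_gzk_of_finite_descentCokernel hGZK hfd`, and of g9's kernel theorem
`LocPKummer.rankOneCountReading_finite_of_gzk` in `KatoDescentIntegralH1RankOne.lean`, which derives it from
Gross–Zagier–Kolyvagin ALONE through the base-level rank bound `rank_{ℤ_p} H¹(ℤ[1/p], T_pW) ≤ 1`). Proof = g7's,
verbatim (pin, admissible body, second `PRRatio` witness, PR-INV, K1 + LOG-HOM, COUNT at `x = z₀`, indices along the pin,
`P_p(p⁻¹) = 1` at the additive `p`), with `hfinH2 := hfin W p D hr hsha hD`. Conditional; nothing asserted.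
[cite: Kato2004Asterisque, (14.9.3) (p. 240), §13.9 (p. 230), §14.14 (14.14.1) (p. 243), Prop. 14.16 (p. 244)]
[cite: BurnsKuriharaSano2019, Thm. 7.3 (p. 29) and Thm. 7.8 (d) (p. 30)] [cite: BlochKato1990, Def. 3.10 and Ex. 3.11]
[cite: Darmon2004, Thm. 3.22] -/
theorem rankOneCountReading_contra_of_finite
    (hGZK : rank_eq_analyticRank_of_analyticRank_le_one)
    (hfin : ∀ (W : WeierstrassCurve ℚ) [W.IsElliptic] [W.IsGloballyMinimal] (p : ℕ) [Fact p.Prime]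
      (D : KatoDescentDatum p), W.analyticRank = 1 → Finite W.sha → IsKatoZetaDescentDatumOfContra W p D →
        Finite (coinvariants p D.H2))
    (hlev : ∀ (N : ℕ) [NeZero N], IsNewformOf.level_eq_conductorNorm (N := N))
    (hLogEx : ∀ (W : WeierstrassCurve ℚ) [W.IsElliptic] [W.IsGloballyMinimal] (p : ℕ) [Fact p.Prime],
      letI : ContinuousSMul ℤ_[p] (W.tateModule p) := TateModule.continuousSMul_padicInt
      ∀ (κ : ZpExtension ℚ p) (γ : absoluteGaloisGroup ℚ), κ.IsCyclotomic → κ.IsTopGenerator γ →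
        W.analyticRank = 1 → ∀ (I : IwasawaH1Data W p κ γ) (x : I.H),
          ∃ t : ℚ_[p], HasLocPKummerLog W p (layerZeroToTop W p κ (I.proj 0 x)) t)
    (hLogHom : ∀ (W : WeierstrassCurve ℚ) [W.IsElliptic] [W.IsGloballyMinimal] (p : ℕ) [Fact p.Prime],
      letI : ContinuousSMul ℤ_[p] (W.tateModule p) := TateModule.continuousSMul_padicInt
      ∀ (x y : H1 (tateRep W p) ⊤) (c₁ c₂ : ℤ_[p]) (s t : ℚ_[p]),
        c₁ • x = c₂ • y → HasLocPKummerLog W p x s → HasLocPKummerLog W p y t →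
          (c₁ : ℚ_[p]) * s = (c₂ : ℚ_[p]) * t)
    (hPRinv : ∀ (W : WeierstrassCurve ℚ) [W.IsElliptic] [W.IsGloballyMinimal] (p : ℕ) [Fact p.Prime]
      (ℒ₁ ℒ₂ : ℚ_[p]), Kato2004.PRRatio W p ℒ₁ → Kato2004.PRRatio W p ℒ₂ → ∃ w : ℚ_[p], ‖w‖ = 1 ∧ ℒ₂ = w * ℒ₁)
    (hCount : ∀ (W : WeierstrassCurve ℚ) [W.IsElliptic] [W.IsGloballyMinimal] (p : ℕ) [Fact p.Prime],
      letI : ContinuousSMul ℤ_[p] (W.tateModule p) := TateModule.continuousSMul_padicInt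
      ∀ (κ : ZpExtension ℚ p) (γ : absoluteGaloisGroup ℚ), κ.IsCyclotomic → κ.IsTopGenerator γ →
        ∀ (I : IwasawaH1Data W p κ γ) (J : IwasawaH2Data W p κ γ I) (x : I.H) (s : ℚ_[p])
          (P : W.toAffine.Point),
          W.analyticRank = 1 → p ≠ 2 → Addv W p → 0 ≤ padicValRat p W.j → ¬ p ∣ W.torsionOrder →
          Finite W.sha →
          (∀ (Y : W.FineSelmerDualData κ γ⁻¹) (𝔮 : PrimeSpectrum (IwasawaAlgebra p)), 𝔮.asIdeal.height = 1 →
            Module.lengthAt (IwasawaAlgebra p) J.H2 𝔮 = Module.lengthAt (IwasawaAlgebra p) Y.X 𝔮) →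
          (∀ Q : W.toAffine.Point, ∃ n : ℤ, IsOfFinAddOrder (Q - n • P)) →
          HasLocPKummerLog W p (layerZeroToTop W p κ (I.proj 0 x)) s →
          (s ≠ 0 ↔ Nat.card (J.A ⧸ (IwasawaAlgebra p) ∙ J.ι (Submodule.Quotient.mk x)) ≠ 0) ∧
            ∀ m : ℕ, Nat.card (J.A ⧸ (IwasawaAlgebra p) ∙ J.ι (Submodule.Quotient.mk x)) =
                p ^ m * Nat.card (coinvariants p J.H2) →
              s.valuation = (m : ℤ) + padicValNat p (Nat.card (AddCommGroup.primaryComponent W.sha p)) +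
                padicValNat p W.tamagawaProduct +
                2 * (padicLogLocal W p
                  (WeierstrassCurve.Affine.Point.map (W' := W.toAffine) (S := ℚ) (Algebra.ofId ℚ ℚ_[p]) P)).valuation) :
    TorsionFree.RankOneCountReading IsKatoZetaDescentDatumOfContra Kato2004.PRRatio := by
  intro W _ _ p _ D ℒ hr hp2 hadd hj htors hsha hD hℒ
  letI instC : ContinuousSMul ℤ_[p] (W.tateModule p) := TateModule.continuousSMul_padicInt
  letI instF : Module.Free ℤ_[p] (W.tateModule p) := W.module_free_tateModule_holds p
  letI instFi : Module.Finite ℤ_[p] (W.tateModule p) := W.module_finite_tateModule_holds p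
  -- conjunct (i): part 1 of the cut
  have hfinH2 : Finite (coinvariants p D.H2) := hfin W p D hr hsha hD
  -- the Mordell–Weil rank (Gross–Zagier–Kolyvagin)
  obtain ⟨hmw, -⟩ := hGZK W (by rw [hr])
  have hrank : W.mordellWeilRank = 1 := by rw [hmw, hr]
  -- the pin, the admissible class and its body
  obtain ⟨Pn, hadm, hH2⟩ := hD
  obtain ⟨hp', N', hN', f', hf', ι', q', Λ', hq', hZ', c', d₁', a', A', d'', hA', hc', hd', hdd', hR', z', x',
    hzeta', y', hy', qm, perRatio', e, u, n₁, n₂, n₃, n₄, σc, σd, σℓ, hqm, -, h₁, h₂, h₃, h₄, -, -, -, hper0',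
    hper', he, hpos⟩ :=
    (Kato2004.isAdmissibleZetaClass_iff W p Pn.κ Pn.isCyclotomic Pn.I (Pn.eH D.z)).mp hadm
  haveI : NeZero N' := hN'
  -- K1: the position clause at the bottom layer
  obtain ⟨c₁, c₂, hc₁, hc₂, hkey, hval⟩ := Pn.I.exists_proj_zero_smul_eq_of_position hf' c' d₁' a' A' d'' hq'
    hqm.ne' hper0' h₁ h₂ h₃ h₄ hR' σc σd σℓ he u hpos
  -- the generator `P` of the given witness (all its other data are discarded)
  obtain ⟨-, N, hN, f, -, -, -, -, -, -, c, d₁, a, A, d', -, -, -, -, -, -, -, -, K, hK, γK, -, IK, y, -, t, P,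
    perRatio, -, hP, -, -⟩ := (Kato2004.prRatio_iff W p ℒ).mp hℒ
  have hlogP := padicLogLocal_map_ne_zero_of_generates p hrank hP
  -- Kummer logarithms on the admissible side (LOG-EX)
  obtain ⟨t', ht'⟩ := hLogEx W p Pn.κ Pn.γ Pn.isCyclotomic Pn.isTopGenerator hr Pn.I y'
  obtain ⟨s, hs⟩ := hLogEx W p Pn.κ Pn.γ Pn.isCyclotomic Pn.isTopGenerator hr Pn.I (Pn.eH D.z)
  -- the admissible family is a second PRRatio witness
  set G : ℚ_[p] := padicLogLocal W p
    (WeierstrassCurve.Affine.Point.map (W' := W.toAffine) (S := ℚ) (Algebra.ofId ℚ ℚ_[p]) P) with hG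
  set M : ℚ := q' * ratCuspFactor f' true c' d₁' a' A' d'' *
    ∏ ℓ ∈ (p * A').primeFactors, eulerFactorAtOne W N' ℓ with hM
  set ℒ' : ℚ_[p] := t' * ((perRatio' : ℚ) : ℚ_[p]) / ((M : ℚ) : ℚ_[p]) / G ^ 2 with hℒ'
  have hℒ'w : Kato2004.PRRatio W p ℒ' :=
    (Kato2004.prRatio_iff W p ℒ').mpr ⟨hp', N', hN', f', hf', ι', q', Λ', hq', hZ', c', d₁', a', A', d'', hA',
      hc', hd', hdd', hR', z', x', hzeta', Pn.κ, Pn.isCyclotomic, Pn.γ, Pn.isTopGenerator, Pn.I, y', hy', t', P,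
      perRatio', ht', hP, hper', by rw [hℒ', hM, hG]⟩
  -- witness independence (PR-INV)
  obtain ⟨w, hw, hℒw⟩ := hPRinv W p ℒ' ℒ hℒ'w hℒ
  -- linearity of the Kummer logarithm (LOG-HOM) on K1's identity, moved to `H¹(⊤, T_pW)`
  have hkey' : c₁ • layerZeroToTop W p Pn.κ (Pn.I.proj 0 (Pn.eH D.z)) =
      c₂ • layerZeroToTop W p Pn.κ (Pn.I.proj 0 y') := by
    have h := congrArg (fun v => layerZeroToTop W p Pn.κ v) hkey
    simp only [map_smul] at h
    exact h
  have hst : (c₁ : ℚ_[p]) * s = (c₂ : ℚ_[p]) * t' := hLogHom W p _ _ c₁ c₂ s t' hkey' hs ht'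
  -- the count over (J.A, 𝐇²_Γ) at x = z₀ (COUNT), and the indices along the pin
  obtain ⟨hii, hiii⟩ := hCount W p Pn.κ Pn.γ Pn.isCyclotomic Pn.isTopGenerator Pn.I Pn.J (Pn.eH D.z) s P
    hr hp2 hadd hj htors hsha hH2 hP hs
  have hidx := zetaIndex_eq_natCard_pin Pn; have hh2 := h2Card_eq_natCard_pin Pn
  -- non-vanishing of the constants
  have hc₁Q : (c₁ : ℚ_[p]) ≠ 0 := PadicInt.coe_ne_zero.mpr hc₁; have hc₂Q : (c₂ : ℚ_[p]) ≠ 0 := PadicInt.coe_ne_zero.mpr hc₂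
  have hw0 : w ≠ 0 := fun h => by rw [h, norm_zero] at hw; exact zero_ne_one hw
  have hE : ∀ ℓ ∈ (p * A').primeFactors, eulerFactorAtOne W N' ℓ ≠ 0 := fun ℓ hℓ =>
    eulerFactorAtOne_ne_zero W hf' (Nat.prime_of_mem_primeFactors hℓ)
  have hM0 : M ≠ 0 := mul_ne_zero (mul_ne_zero hq' hR') (Finset.prod_ne_zero_iff.mpr hE)
  have hMQ : ((M : ℚ) : ℚ_[p]) ≠ 0 := by exact_mod_cast hM0
  have hlamQ : ((perRatio' : ℚ) : ℚ_[p]) ≠ 0 := by exact_mod_cast hper0'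
  have hst' : s = 0 ↔ t' = 0 := by
    constructor
    · intro h0; rw [h0, mul_zero] at hst; exact (mul_eq_zero.mp hst.symm).resolve_left hc₂Q
    · intro h0; rw [h0, mul_zero] at hst; exact (mul_eq_zero.mp hst).resolve_left hc₁Q
  have hℒ'C : ℒ' = t' * (((perRatio' : ℚ) : ℚ_[p]) / ((M : ℚ) : ℚ_[p]) / G ^ 2) := by
    rw [hℒ']; ring
  have hC0 : ((perRatio' : ℚ) : ℚ_[p]) / ((M : ℚ) : ℚ_[p]) / G ^ 2 ≠ 0 :=
    div_ne_zero (div_ne_zero hlamQ hMQ) (pow_ne_zero 2 hlogP)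
  have hℒ't : ℒ' = 0 ↔ t' = 0 := by
    rw [hℒ'C, mul_eq_zero, or_iff_left hC0]
  refine ⟨hfinH2, ?_, ?_⟩
  · -- conjunct (ii)
    rw [hidx, ← hii, hℒw, mul_ne_zero_iff]
    exact ⟨fun h hs0 => h.2 (hℒ't.mpr (hst'.mp hs0)), fun h => ⟨hw0, fun h' => h (hst'.mpr (hℒ't.mp h'))⟩⟩
  · -- conjunct (iii)
    intro m hm
    rw [hidx, hh2] at hm
    have hsv := hiii m hm
    haveI : Finite (coinvariants p Pn.J.H2) := Finite.of_equiv _ (coinvariantsEquiv Pn.eH2).toEquiv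
    have hcard : Nat.card (Pn.J.A ⧸ (IwasawaAlgebra p) ∙ Pn.J.ι (Submodule.Quotient.mk (Pn.eH D.z))) ≠ 0 := by
      rw [hm]
      exact mul_ne_zero (pow_ne_zero _ (Fact.out : p.Prime).ne_zero) Nat.card_pos.ne'
    have hs0 : s ≠ 0 := hii.mpr hcard
    have ht0 : t' ≠ 0 := fun h => hs0 (hst'.mpr h); have hℒ'0 : ℒ' ≠ 0 := fun h => ht0 (hℒ't.mp h)
    rw [hℒw, Padic.valuation_mul hw0 hℒ'0, valuation_eq_zero_of_norm_eq_one_aux hw, zero_add]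
    have hvℒ' : ℒ'.valuation = t'.valuation + padicValRat p perRatio' - padicValRat p M - 2 * G.valuation := by
      rw [hℒ', valuation_mul_div_div_sq_aux ht0 hlamQ hMQ hlogP, Padic.valuation_ratCast, Padic.valuation_ratCast]
    have hvs : (c₁ : ℚ_[p]).valuation + s.valuation = (c₂ : ℚ_[p]).valuation + t'.valuation := by
      have := congrArg Padic.valuation hst
      rwa [Padic.valuation_mul hc₁Q hs0, Padic.valuation_mul hc₂Q ht0] at this
    have hMeq : M = q' * ratCuspFactor f' true c' d₁' a' A' d'' *
        ∏ ℓ ∈ A'.primeFactors.erase p, eulerFactorAtOne W N' ℓ := by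
      rw [hM, prod_eulerFactorAtOne_primeFactors_mul_eq_of_addv W p hadd (hlev N' hf') hA']
    have hρ : padicValRat p (perRatio' / (q' * ratCuspFactor f' true c' d₁' a' A' d'' *
        ∏ ℓ ∈ A'.primeFactors.erase p, eulerFactorAtOne W N' ℓ)) = padicValRat p perRatio' - padicValRat p M := by
      rw [← hMeq, padicValRat.div hper0' hM0]
    rw [hρ] at hval; rw [hvℒ']; linarith


end Reduction

end Summit.BirchSwinnertonDyer.Rank1Residual.Additive.ContraCount

end
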